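import Literature.AlgebraicGeometry.Motives.Jacobian
import Literature.AlgebraicGeometry.Motives.AbelianVarietyRigidity
import Literature.AlgebraicGeometry.Motives.VarietiesProperProofs
import Literature.AlgebraicGeometry.Motives.VarietiesGeometricallyIntegralProofs
import HarnessLib

/-!
# Jacobians from the pointed universal property; abelian varieties are their own Jacobians

Two proved pieces of the existence statement `nonempty_jacobian_of_isSmoothProjective`
(`Motives/Jacobian`: Milne, *Jacobian Varieties*, Thm. 1.1 with Prop. 6.4), following the printed
proof of Milne's Prop. 6.4 (Cornell–Silverman, *Arithmetic Geometry*, Ch. VII, p. 189):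

* `Jacobian.ofPointed` — **Prop. 6.4 from Prop. 6.1.** If `C` is complete and geometrically
  integral with a rational point `P ∈ C(k)`, and `(J, f : C → J)` with `f(P) = 0` has the universal
  property of Milne's Prop. 6.1 (every `g : C → A` into an abelian variety with `g(P) = 0` factors
  uniquely through a homomorphism `J → A`), then `J` with the difference map
  `F(x, y) = f(x) − f(y)` is a `Jacobian C`: for `φ : C × C → A` with `φ(Δ) = 0`, Milne AV Cor. 2.5
  (`eq_mul_of_point_comp_eq_one`, `Motives/AbelianVarietyRigidity`) gives
  `φ(a, b) = φ₁(a) + φ₂(b)` with `φ₁ = φ|C × {P}`, `φ₂ = φ|{P} × C`; `φ(Δ) = 0` forces `φ₂ = −φ₁`;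
  Prop. 6.1 gives `φ₁ = ψ ∘ f`, whence `φ = ψ ∘ F`, and uniqueness follows from `F(x, P) = f(x)`.
  `nonempty_of_pointed` is the same for `IsSmoothProjective 1 C` (completeness and geometric
  integrality being the discharged facts `IsSmoothProjective.isProper_holds`,
  `IsSmoothProjective.geometricallyIntegral_holds`). What this leaves of the named fact is exactly
  Milne Thm. 1.1 + Prop. 6.1 (existence of `(J, f^P)`, §§3–5: symmetric powers, Riemann–Roch) and
  the Galois-descent step of Prop. 6.4 for curves without a rational point.
* `Jacobian.ofAbelianVariety` — **an abelian variety is its own Albanese variety**: `(A, x − y)`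
  is a `Jacobian A.X`, because the pointed pair `(A, 𝟙_A)` has the property of Prop. 6.1 by Milne
  AV Cor. 2.2 (`isMonHom_of_one_comp`: a morphism with `0 ↦ 0` is a homomorphism,
  `AbelianVariety.homOfOneComp`). In particular elliptic curves are their own Jacobians, and the
  structure `Jacobian` is inhabited non-vacuously.
* glue between the two models of the base point, `specOver k k` (used by `AlgPoints`) and the
  monoidal unit `𝟙_ (Over (Spec k))` (used by Mathlib's group-object API): `eq_toSpecOver`,
  `AlgPoints.toUnitHom`, `AlgPoints.toUnit_comp_toUnitHom`.

## References

* J. S. Milne, *Jacobian Varieties*, Ch. VII of Cornell–Silverman (eds.), *Arithmetic Geometry*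
  (1986): §6 Prop. 6.1, Prop. 6.4 and its proof, Remark 6.5. [Milne1986JacobianVarieties]
* J. S. Milne, *Abelian Varieties*, ibid. Ch. V: Thm. 2.1, Cor. 2.2, Remark 2.3, Cor. 2.5.
  [Milne1986AbelianVarieties]
-/

noncomputable section

open CategoryTheory Limits AlgebraicGeometry MonoidalCategory CartesianMonoidalCategory

universe u

namespace Literature.AlgebraicGeometry.Motives

open scoped MonObj

variable {k : Type u} [Field k]

/-! ### Homomorphisms from origin-preserving morphisms (Milne AV Cor. 2.2) -/

namespace AbelianVariety

variable {A B : AbelianVariety k}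

/-- The homomorphism of abelian varieties underlying a `k`-morphism `f : A → B` with `f(0) = 0`
(Milne, *Abelian Varieties*, Cor. 2.2 and Remark 2.3: the group structure is determined by the
zero element; the homomorphism property is `isMonHom_of_one_comp`).
[cite: Milne1986AbelianVarieties, §2 Cor. 2.2] -/
def homOfOneComp (f : A.X ⟶ B.X) (hf : η[A.X] ≫ f = η[B.X]) : A ⟶ B :=
  haveI := isMonHom_of_one_comp f hf
  InducedCategory.homMk (Grp.homMk f)

/-- The underlying morphism of `homOfOneComp f hf` is `f` (by `rfl`). [folklore] -/
@[simp]
theorem homOfOneComp_hom_hom_hom (f : A.X ⟶ B.X) (hf : η[A.X] ≫ f = η[B.X]) :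
    (homOfOneComp f hf).hom.hom.hom = f :=
  rfl

end AbelianVariety

/-! ### Points `Spec k → X`: the two models `specOver k k` and `𝟙_` of the base -/

/-- Every `k`-morphism into `specOver k k = (Spec k → Spec k)` is the structure morphism: the
object `specOver k k` is terminal in `Over (Spec k)`. [folklore] -/
theorem eq_toSpecOver {X : SchemeOver k} (g : X ⟶ specOver k k) : g = toSpecOver X := by
  apply Over.OverMorphism.ext
  rw [toSpecOver_left, ← Over.w g]
  simp only [specOver, Over.mk_hom, Algebra.algebraMap_self, CommRingCat.ofHom_id, Spec.map_id]
  exact (Category.comp_id _).symm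

/-- The rational point `𝟙_ ⟶ X` (a section of the terminal object of `Over (Spec k)`) defined by a
`k`-point `P ∈ X(k) = (specOver k k ⟶ X)`. [folklore] -/
def AlgPoints.toUnitHom {X : SchemeOver k} (P : AlgPoints X k) : 𝟙_ (SchemeOver k) ⟶ X :=
  toSpecOver _ ≫ P

/-- The constant map `T → Spec k → X` at `P` in the two models of the base agree:
`toUnit T ≫ P.toUnitHom = toSpecOver T ≫ P`. [folklore] -/
@[reassoc]
theorem AlgPoints.toUnit_comp_toUnitHom {X T : SchemeOver k} (P : AlgPoints X k) :
    toUnit T ≫ P.toUnitHom = toSpecOver T ≫ P := by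
  rw [AlgPoints.toUnitHom, ← Category.assoc, eq_toSpecOver (toUnit T ≫ toSpecOver _)]

/-- `P ≫ toSpecOver T ≫ Q = Q`: a point followed by a constant map is that constant. [folklore] -/
@[reassoc]
theorem AlgPoints.comp_toSpecOver_comp {X T : SchemeOver k} (P : AlgPoints T k)
    (Q : AlgPoints X k) : P ≫ toSpecOver T ≫ Q = Q := by
  rw [← Category.assoc, eq_toSpecOver (P ≫ toSpecOver T)]
  change toSpecOver (specOver k k) ≫ Q = Q
  rw [← eq_toSpecOver (𝟙 (specOver k k)), Category.id_comp]

namespace Jacobian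

variable {C : SchemeOver k}

/-! ### Milne's Prop. 6.4 from the pointed universal property Prop. 6.1 -/

/-- For `φ : C × C → A` vanishing on the diagonal, `φ₁ = φ|C × {P}` vanishes at `P`. [folklore] -/
theorem point_comp_sliceHom (P : AlgPoints C k) {A : AbelianVariety k} (φ : C ⊗ C ⟶ A.X)
    (hφ : lift (𝟙 C) (𝟙 C) ≫ φ = 1) :
    P ≫ (lift (𝟙 C) (toUnit C ≫ P.toUnitHom) ≫ φ) = 1 := by
  rw [comp_lift_assoc, Category.comp_id, P.toUnit_comp_toUnitHom, P.comp_toSpecOver_comp,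
    show lift P P = P ≫ lift (𝟙 C) (𝟙 C) by simp, Category.assoc, hφ, MonObj.comp_one]

/-- **Milne, Jacobian Varieties, Prop. 6.4 from Prop. 6.1** (second half of the printed proof):
over a field `k` such that `C` (complete, geometrically integral) has a rational point `P`, an
abelian variety `J` with a morphism `f = f^P : C → J`, `f(P) = 0`, having the universal property of
Prop. 6.1 for pointed maps into abelian varieties (`descP`, `facP`, `uniqP`), is a Jacobian of `C`
in the sense of `Literature.AlgebraicGeometry.Motives.Jacobian`: the difference map is
`F(x, y) = f(x) − f(y)`, and a `φ : C × C → A` with `φ(Δ) = 0` is `φ(a, b) = φ₁(a) + φ₂(b)` with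
`φ₁(P) = 0 = φ₂(P)` (Milne AV Cor. 2.5, `eq_mul_of_point_comp_eq_one`), `φ₁ = −φ₂` because
`φ(Δ) = 0`, `φ₁ = ψ ∘ f` by 6.1, and then `φ = ψ ∘ F`. (The first half of Milne's proof — Galois
descent from a finite Galois `k'/k` with `C(k') ≠ ∅` — is not formalised here.)
[cite: Milne1986JacobianVarieties, §6 Prop. 6.4 (proof) and Prop. 6.1] -/
def ofPointed [IsProper C.hom] [GeometricallyIntegral C.hom] (P : AlgPoints C k)
    (J : AbelianVariety k) (f : C ⟶ J.X) (hf : P ≫ f = 1)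
    (descP : ∀ {A : AbelianVariety k} (g : C ⟶ A.X), P ≫ g = 1 → (J ⟶ A))
    (facP : ∀ {A : AbelianVariety k} (g : C ⟶ A.X) (hg : P ≫ g = 1),
      f ≫ (descP g hg).hom.hom.hom = g)
    (uniqP : ∀ {A : AbelianVariety k} (g : C ⟶ A.X) (hg : P ≫ g = 1) (ψ : J ⟶ A),
      f ≫ ψ.hom.hom.hom = g → ψ = descP g hg) :
    Jacobian C where
  J := J
  diff := (fst C C ≫ f) * (snd C C ≫ f)⁻¹
  diff_cocycle := by
    simp only [MonObj.comp_mul, GrpObj.comp_inv, lift_fst_assoc, lift_snd_assoc, Category.assoc]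
    rw [mul_assoc, inv_mul_cancel_left]
  desc φ hφ := descP (lift (𝟙 C) (toUnit C ≫ P.toUnitHom) ≫ φ) (point_comp_sliceHom P φ hφ)
  fac φ hφ := by
    -- Milne AV Cor. 2.5: `φ(a, b) = φ₁(a) · φ₂(b)`, and `φ₂ = φ₁⁻¹` since `φ(Δ) = 1`.
    have h0 : lift P.toUnitHom P.toUnitHom ≫ φ = 1 := by
      rw [show lift P.toUnitHom P.toUnitHom = P.toUnitHom ≫ lift (𝟙 C) (𝟙 C) by simp,
        Category.assoc, hφ, MonObj.comp_one]
    have key := eq_mul_of_point_comp_eq_one φ P.toUnitHom P.toUnitHom h0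
    have h12 : lift (toUnit C ≫ P.toUnitHom) (𝟙 C) ≫ φ =
        (lift (𝟙 C) (toUnit C ≫ P.toUnitHom) ≫ φ)⁻¹ := by
      have h := hφ
      rw [key, MonObj.comp_mul, lift_fst_assoc, lift_snd_assoc, Category.id_comp,
        Category.id_comp] at h
      exact eq_inv_of_mul_eq_one_right h
    rw [h12, GrpObj.comp_inv] at key
    rw [MonObj.mul_comp, GrpObj.inv_comp, Category.assoc, Category.assoc, facP]
    exact key.symm
  uniq φ hφ ψ hψ := by
    apply uniqP
    have hPf : (toUnit C ≫ P.toUnitHom) ≫ f = 1 := by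
      rw [Category.assoc, P.toUnit_comp_toUnitHom_assoc, hf, MonObj.comp_one]
    rw [← hψ, ← Category.assoc, MonObj.comp_mul, GrpObj.comp_inv, lift_fst_assoc,
      lift_snd_assoc, Category.id_comp, hPf, inv_one, mul_one]

section OfPointed

variable [IsProper C.hom] [GeometricallyIntegral C.hom] (P : AlgPoints C k)
  (J : AbelianVariety k) (f : C ⟶ J.X) (hf : P ≫ f = 1)
  (descP : ∀ {A : AbelianVariety k} (g : C ⟶ A.X), P ≫ g = 1 → (J ⟶ A))
  (facP : ∀ {A : AbelianVariety k} (g : C ⟶ A.X) (hg : P ≫ g = 1),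
    f ≫ (descP g hg).hom.hom.hom = g)
  (uniqP : ∀ {A : AbelianVariety k} (g : C ⟶ A.X) (hg : P ≫ g = 1) (ψ : J ⟶ A),
    f ≫ ψ.hom.hom.hom = g → ψ = descP g hg)

/-- The abelian variety of `ofPointed` is the given `J` (by `rfl`). [folklore] -/
@[simp]
theorem ofPointed_J : (ofPointed P J f hf descP facP uniqP).J = J := rfl

/-- The difference map of `ofPointed` is `F(x, y) = f(x) − f(y)` (Milne §6, definition of `F`;
by `rfl`). [cite: Milne1986JacobianVarieties, §6 (before Prop. 6.4)] -/
theorem ofPointed_diff :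
    (ofPointed P J f hf descP facP uniqP).diff = (fst C C ≫ f) * (snd C C ≫ f)⁻¹ := rfl

/-- The canonical map `f^P` of the Jacobian `ofPointed` at the base point `P` is the given `f`
(Milne §6: `F(x, P) = f^P(x) − f^P(P) = f^P(x)`). [cite: Milne1986JacobianVarieties, §2 and §6] -/
theorem ofPointed_abelJacobi : (ofPointed P J f hf descP facP uniqP).abelJacobi P = f := by
  change lift (𝟙 C) (toSpecOver C ≫ P) ≫ ((fst C C ≫ f) * (snd C C ≫ f)⁻¹) = f
  rw [MonObj.comp_mul, GrpObj.comp_inv, lift_fst_assoc, lift_snd_assoc, Category.id_comp,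
    Category.assoc, hf, MonObj.comp_one, inv_one, mul_one]

end OfPointed

/-- **Milne Thm. 1.1 + Prop. 6.1 ⇒ the named fact, for curves with a rational point**: a smooth
projective curve `C/k` with `P ∈ C(k)` and an abelian variety `J` with `f : C → J`, `f(P) = 0`,
universal for pointed maps into abelian varieties (Milne, *Jacobian Varieties*, Prop. 6.1) has a
Jacobian in the sense of `Jacobian C` (Prop. 6.4). Completeness and geometric integrality of `C`
are the discharged facts `IsSmoothProjective.isProper_holds`, `.geometricallyIntegral_holds`.
[cite: Milne1986JacobianVarieties, §6 Prop. 6.1 and Prop. 6.4] -/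
theorem nonempty_of_pointed (hC : IsSmoothProjective 1 C) (P : AlgPoints C k)
    (J : AbelianVariety k) (f : C ⟶ J.X) (hf : P ≫ f = 1)
    (descP : ∀ {A : AbelianVariety k} (g : C ⟶ A.X), P ≫ g = 1 → (J ⟶ A))
    (facP : ∀ {A : AbelianVariety k} (g : C ⟶ A.X) (hg : P ≫ g = 1),
      f ≫ (descP g hg).hom.hom.hom = g)
    (uniqP : ∀ {A : AbelianVariety k} (g : C ⟶ A.X) (hg : P ≫ g = 1) (ψ : J ⟶ A),
      f ≫ ψ.hom.hom.hom = g → ψ = descP g hg) :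
    Nonempty (Jacobian C) :=
  haveI := IsSmoothProjective.isProper_holds hC
  haveI := IsSmoothProjective.geometricallyIntegral_holds hC
  ⟨ofPointed P J f hf descP facP uniqP⟩

/-! ### An abelian variety is its own Jacobian (Albanese) -/

/-- **An abelian variety is its own Albanese variety**: `(A, (x, y) ↦ x − y)` is a Jacobian of the
`k`-scheme `A` in the sense of `Jacobian` — every `φ : A × A → B` into an abelian variety with
`φ(Δ) = 0` is `ψ(x − y)` for a unique homomorphism `ψ` (namely `ψ(x) = φ(x, 0)`, a homomorphism by
Milne AV Cor. 2.2, and `φ(x, y) = φ(x, 0) + φ(0, y) = ψ(x) − ψ(y)` by Cor. 2.5). This is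
`ofPointed` for the pointed pair `(A, 𝟙_A)` at the origin, whose universal property (Prop. 6.1
shape) is Cor. 2.2; in particular an elliptic curve `E` is its own Jacobian.
[cite: Milne1986AbelianVarieties, §2 Cor. 2.2 and Cor. 2.5] -/
def ofAbelianVariety (A : AbelianVariety k) : Jacobian A.X :=
  ofPointed (1 : AlgPoints A.X k) A (𝟙 A.X) (Category.comp_id _)
    (fun g hg => AbelianVariety.homOfOneComp g (by
      rw [MonObj.one_eq_one, MonObj.one_eq_one,
        ← MonObj.comp_one (toSpecOver (𝟙_ (SchemeOver k))), Category.assoc, hg,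
        MonObj.comp_one]))
    (fun _ _ => Category.id_comp _)
    (fun g _ ψ hψ => AbelianVariety.hom_ext _ _ (by
      rw [AbelianVariety.homOfOneComp_hom_hom_hom, ← hψ, Category.id_comp]))

/-- The Jacobian variety of `ofAbelianVariety A` is `A` (by `rfl`). [folklore] -/
@[simp]
theorem ofAbelianVariety_J (A : AbelianVariety k) : (ofAbelianVariety A).J = A := rfl

/-- The difference map of `ofAbelianVariety A` is `(x, y) ↦ x · y⁻¹`. [folklore] -/
theorem ofAbelianVariety_diff (A : AbelianVariety k) :
    (ofAbelianVariety A).diff = fst A.X A.X * (snd A.X A.X)⁻¹ := by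
  change (fst A.X A.X ≫ 𝟙 A.X) * (snd A.X A.X ≫ 𝟙 A.X)⁻¹ = fst A.X A.X * (snd A.X A.X)⁻¹
  simp only [Category.comp_id]

/-- Every abelian variety (in particular every elliptic curve) has a Jacobian in the sense of
`Jacobian`, namely itself. [cite: Milne1986AbelianVarieties, §2 Cor. 2.2 and Cor. 2.5] -/
theorem nonempty_jacobian_abelianVariety (A : AbelianVariety k) : Nonempty (Jacobian A.X) :=
  ⟨ofAbelianVariety A⟩

end Jacobian

end Literature.AlgebraicGeometry.Motives
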